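import Summits.BirchSwinnertonDyer.BirchSwinnertonDyer.Theorems.ThetaPartnerAtTwoSignedTransportAtTwoLocalFactorTools
import Literature.AnabelianGeometry.AbsoluteAnabelian.FreeProcyclicOpenSubgroup
import HarnessLib

/-!
# The local factor over a `ℤ_p`-tower is the EVENTUALLY-FROBENIUS-FIXED part of `H¹` of inertia:
# `im(H¹(P, X) → H¹(N, X)) = {y : ∃ n, φ^{p^n}·y = y}` for `P = ker κ ⊇ N` (abstract profinite form of the
# structure behind GV 2000 Prop. (2.4) READ AT any `p`; line `bridge`, crux `SignedTransportAtTwo`,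
# stmt-BirchSwinnertonDyer-20333, route `ThetaPartnerAtTwo`; lead prover bsd-wall-tp2-p1 g7; `--supports`, route-independent)

HONEST FRAMING. THEOREMS ONLY; no definition; BSD is not proved by any of this. ABSTRACT SETTING (model: `Γ = Γ_F`
the absolute Galois group of a non-archimedean local field `F` of residue characteristic `ℓ ≠ p`, `N = I_F` its inertia
group, `φ` a Frobenius, `κ : Γ_F → ℤ_p` the cyclotomic `ℤ_p`-extension restricted to `F` — unramified, `κ(φ) ≠ 0` — and
`P = ker κ = Gal(F̄/F_{∞,η})`, `X = E[p^∞]`): `Γ` profinite, `N ⊴ Γ` closed with `Γ ⧸ N` free procyclic topologically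
generated by `φ̄`, `κ : Γ →ₜ* ℤ_p` (multiplicative notation) killing `N` with `κ φ ≠ 1`, `P = ker κ`, and `X` a discrete
`p`-primary `Γ`-module with finite `p^k`-torsion. Then the image of the restriction `H¹(P, X) → H¹(N, X)` — GV's local
factor `𝓗_η = H¹(F_{∞,η}, E[p^∞]) ↪ H¹(I_η, E[p^∞])` at ONE place `η` of the tower — is EXACTLY the set of classes of
`H¹(N, X)` fixed by `φ^{p^n}` for some `n` (`range_resLe_eq_eventually_fixed`-shaped statements below):

* `⊆` (`exists_conjMap_pow_eq_of_resLe`): a class restricted from `P` is fixed by `P` (inner action) and by an OPEN normal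
  subgroup (discrete coefficients, compact `N`: `exists_openNormalSubgroup_forall_conjMap_eq`), hence by the closed
  subgroups `G_n = κ⁻¹(cl⟨κ(φ)^{p^n}⟩) ∋ φ^{p^n}` for `n ≫ 0` (`⋂ G_n = P`, compactness);
* `⊇` (`exists_resLe_eq_of_conjMap_pow_eq`): a class fixed by `φ^{p^n}` extends to the profinite group `G_n = N ⋊ cl⟨φ^{p^n}⟩`
  by the tree's `H²`-free extension theorem `exists_resSubgroup_eq_of_conjMap_eq` (retraction `G_n → cl⟨φ^{p^n}⟩`,
  free procyclicity of `cl⟨φ^{p^n}⟩`, (KM4) for torsion discrete coefficients from the finite case), then restricts to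
  `P ≤ G_n`.

References: [GreenbergVatsal2000] §2 pp. 16–17, 20–22 (the local factors `𝓗_ℓ(ℚ_∞)`, Prop. (2.4));
[NeukirchSchmidtWingberg2008] (1.6.7), Thm. 7.5.3; [SerreGaloisCohomology1997] I §2.6 (b); [Rubin2000] Lemma 1.3.2.
-/

set_option autoImplicit false
-- D-0017: single-problem summit, so `Summit.BirchSwinnertonDyer.BirchSwinnertonDyer.…` repeats a namespace BY DESIGN.
set_option linter.dupNamespace false

noncomputable section

open CategoryTheory Function Topology
open scoped Pointwise
open _root_.Subgroup
open Literature.NumberTheory.GaloisRepresentations Literature.AnabelianGeometry.AbsoluteAnabelian Literature.GroupTheory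
open Literature.NumberTheory.EllipticCurves (subgroupConj subgroupConj_apply_coe subgroupInclusion subgroupInclusion_apply_coe)

namespace Summit.BirchSwinnertonDyer.BirchSwinnertonDyer.Theorems.SignedTransportAtTwo

universe u v

/-! ## §4. The tower `G_n = r⁻¹(cl⟨φ^{p^n}⟩)` cut out by `κ`, and the main equivalence -/

section Tower

variable {Γ : Type u} [Group Γ] [TopologicalSpace Γ] [IsTopologicalGroup Γ] [CompactSpace Γ] [T2Space Γ]
  [TotallyDisconnectedSpace Γ]

/-- The set of elements of `ℤ_p` (multiplicative notation) of the form `(p^n α) β` is closed (a continuous image of the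
compact `ℤ_p`). [folklore] -/
theorem isClosed_setOf_exists_toAdd_eq {p : ℕ} [Fact p.Prime] (a : ℤ_[p]) :
    IsClosed {x : Multiplicative ℤ_[p] | ∃ β : ℤ_[p], Multiplicative.toAdd x = a * β} := by
  have : {x : Multiplicative ℤ_[p] | ∃ β : ℤ_[p], Multiplicative.toAdd x = a * β} =
      Set.range fun β : ℤ_[p] => Multiplicative.ofAdd (a * β) := by
    ext x
    simp only [Set.mem_setOf_eq, Set.mem_range]
    constructor
    · rintro ⟨β, hβ⟩; exact ⟨β, by rw [← hβ, ofAdd_toAdd]⟩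
    · rintro ⟨β, rfl⟩; exact ⟨β, toAdd_ofAdd _⟩
  rw [this]
  exact (isCompact_range (continuous_ofAdd.comp (continuous_const.mul continuous_id))).isClosed

variable {p : ℕ} [Fact p.Prime]

omit [CompactSpace Γ] [T2Space Γ] [TotallyDisconnectedSpace Γ] in
/-- **The image of `cl⟨φ^{m}⟩` under `κ` consists of `p`-adic multiples of `m·κ(φ)`**: for a closed subgroup `C` of `Γ`,
`φ ∈ C`, and the open subgroup `D = cl⟨φ_C^m⟩` of `C`, every `d` in the image of `D` in `Γ` has `κ(d) = (m α) β` with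
`α = κ(φ)` (continuity of `κ`, closedness of the target set). [folklore] -/
theorem exists_toAdd_eq_of_mem_map_closure (κ : Γ →ₜ* Multiplicative ℤ_[p]) {C : Subgroup Γ} {φ : Γ} (hφ : φ ∈ C)
    (m : ℕ) {d : Γ} (hd : d ∈ ((zpowers ((⟨φ, hφ⟩ : C) ^ m)).topologicalClosure).map C.subtype) :
    ∃ β : ℤ_[p], Multiplicative.toAdd (κ d) = ((m : ℤ_[p]) * Multiplicative.toAdd (κ φ)) * β := by
  obtain ⟨y, hy, rfl⟩ := Subgroup.mem_map.1 hd
  set T : Set C := {y : C | ∃ β : ℤ_[p], Multiplicative.toAdd (κ (y : Γ)) =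
    ((m : ℤ_[p]) * Multiplicative.toAdd (κ φ)) * β} with hT
  have hTc : IsClosed T :=
    (isClosed_setOf_exists_toAdd_eq ((m : ℤ_[p]) * Multiplicative.toAdd (κ φ))).preimage
      (κ.continuous_toFun.comp continuous_subtype_val)
  -- `T` is a closed subgroup of `C` containing `φ_C^m`
  let T' : Subgroup C :=
    { carrier := T
      mul_mem' := by
        rintro a b ⟨βa, ha⟩ ⟨βb, hb⟩
        refine ⟨βa + βb, ?_⟩
        change Multiplicative.toAdd (κ ((a * b : C) : Γ)) = _
        rw [Subgroup.coe_mul, map_mul, toAdd_mul, ha, hb]; ring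
      one_mem' := by
        refine ⟨0, ?_⟩
        change Multiplicative.toAdd (κ ((1 : C) : Γ)) = _
        rw [Subgroup.coe_one, map_one, toAdd_one]; ring
      inv_mem' := by
        rintro a ⟨βa, ha⟩
        refine ⟨-βa, ?_⟩
        change Multiplicative.toAdd (κ ((a⁻¹ : C) : Γ)) = _
        rw [Subgroup.coe_inv, map_inv, toAdd_inv, ha]; ring }
  have hsub : zpowers ((⟨φ, hφ⟩ : C) ^ m) ≤ T' := by
    rw [Subgroup.zpowers_le]
    refine ⟨(1 : ℤ_[p]), ?_⟩
    rw [Subgroup.coe_pow, Subgroup.coe_mk, map_pow, toAdd_pow, nsmul_eq_mul]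
    ring
  have hT'c : IsClosed (T' : Set C) := hTc
  exact Subgroup.topologicalClosure_minimal _ hsub hT'c hy

/-- **Main structure theorem (abstract form).** `Γ` profinite, `N ⊴ Γ` closed with `Γ ⧸ N` free procyclic topologically generated
by the image of `φ`, `κ : Γ → ℤ_p` a continuous homomorphism killing `N` with `κ φ ≠ 1` (multiplicative notation), `P = ker κ`,
and `X` a discrete `p`-primary `Γ`-module with finite `p^k`-torsion. Then a class of `H¹(N, X)` is restricted from `H¹(P, X)`
iff it is fixed by `φ^{p^n}` for some `n`:
`im(H¹(P, X) → H¹(N, X)) = {y : ∃ n, φ^{p^n}·y = y}`. For `Γ = Γ_F` (`F` local, residue characteristic `≠ p`), `N = I_F`,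
`κ` the cyclotomic character to `ℤ_p` and `X = E[p^∞]` the left side is Greenberg–Vatsal's local factor
`H¹(F_{∞,η}, E[p^∞]) ↪ H¹(I_η, E[p^∞])` at one place `η` of the cyclotomic tower.
[cite: GreenbergVatsal2000, §2 pp. 16–17 and Prop. (2.4) (p. 22)] [cite: NeukirchSchmidtWingberg2008, (1.6.7)] -/
theorem exists_resLe_ker_eq_iff_exists_conjMap_pow_eq
    {M : Type u} [AddCommGroup M] [TopologicalSpace M] [DiscreteTopology M] (τ : ContinuousRep Γ ℤ M)
    (htor : ∀ m : M, ∃ k : ℕ, p ^ k • m = 0) (hfin : ∀ k : ℕ, Set.Finite {m : M | p ^ k • m = 0})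
    (N : Subgroup Γ) [N.Normal] (hN : IsClosed (N : Set Γ)) (hfree : FundamentalExtension.IsFreeProcyclic (Γ ⧸ N))
    (φ : Γ) (hφ : Dense (zpowers (QuotientGroup.mk φ : Γ ⧸ N) : Set (Γ ⧸ N)))
    (κ : Γ →ₜ* Multiplicative ℤ_[p]) (hκN : ∀ n ∈ N, κ n = 1) (hκφ : κ φ ≠ 1)
    (hNP : N ≤ κ.toMonoidHom.ker)
    (yc : continuousCohomology 1 (subgroupRep τ.toTopRep N)) :
    (∃ zc : continuousCohomology 1 (subgroupRep τ.toTopRep κ.toMonoidHom.ker), resLe τ.toTopRep hNP 1 zc = yc) ↔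
      ∃ n : ℕ, conjMap τ.toTopRep N (φ ^ p ^ n) 1 yc = yc := by
  classical
  set P : Subgroup Γ := κ.toMonoidHom.ker with hPdef
  have hp : p.Prime := Fact.out
  -- the retraction `r : Γ → C = cl⟨φ⟩` with kernel `N`
  obtain ⟨r, hrC, hrid, hker⟩ := exists_continuousMonoidHom_retraction_of_isFreeProcyclic N hN hfree φ hφ
  set C : Subgroup Γ := (zpowers φ).topologicalClosure with hCdef
  have hCc : IsClosed (C : Set Γ) := Subgroup.isClosed_topologicalClosure _
  haveI : CompactSpace C := isCompact_iff_compactSpace.mp hCc.isCompact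
  have hfreeC : FundamentalExtension.IsFreeProcyclic C := isFreeProcyclic_topologicalClosure_zpowers N hN hfree φ hφ
  have hφC : φ ∈ C := Subgroup.le_topologicalClosure _ (Subgroup.mem_zpowers φ)
  set φC : C := ⟨φ, hφC⟩ with hφCdef
  have hdenseC : Dense (zpowers φC : Set C) := dense_zpowers_mk_topologicalClosure' φ
  -- `κ` factors through `r`: `κ g = κ (r g)`
  have hκr : ∀ g : Γ, κ g = κ (r g) := fun g => by
    have h1 : κ (g * (r g)⁻¹) = 1 := hκN _ (mul_inv_retraction_mem r hrC hrid hker g)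
    rw [map_mul, map_inv, mul_inv_eq_one] at h1
    exact h1
  -- the open subgroups `D n = cl⟨φ_C^{p^n}⟩` of `C`, their images `C_n ≤ Γ`, and `G_n = r⁻¹(C_n)`
  set D : ℕ → Subgroup C := fun n => (zpowers (φC ^ p ^ n)).topologicalClosure with hDdef
  have hD : ∀ n, IsOpen (D n : Set C) ∧ (D n).index = p ^ n := fun n =>
    isOpen_closureZpowersPow hdenseC (pow_pos hp.pos n) (hfreeC.exists_isOpen_index _ (pow_pos hp.pos n))
  set Cn : ℕ → Subgroup Γ := fun n => (D n).map C.subtype with hCndef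
  have hCnC : ∀ n, Cn n ≤ C := fun n => Subgroup.map_subtype_le _
  have hCnc : ∀ n, IsClosed (Cn n : Set Γ) := fun n => by
    have hcpt : IsCompact (D n : Set C) := ((hD n).1 |> Subgroup.isClosed_of_isOpen _).isCompact
    have : (Cn n : Set Γ) = Subtype.val '' (D n : Set C) := by
      ext x; simp [hCndef]
    rw [this]
    exact (hcpt.image continuous_subtype_val).isClosed
  have hψCn : ∀ n, φ ^ p ^ n ∈ Cn n := fun n =>
    Subgroup.mem_map.2 ⟨φC ^ p ^ n, Subgroup.le_topologicalClosure _ (Subgroup.mem_zpowers _), by simp [hφCdef]⟩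
  -- the avatar `D n ≃ₜ* C_n`
  have eCn : ∀ n, ∃ e : D n ≃ₜ* Cn n, e ⟨φC ^ p ^ n, Subgroup.le_topologicalClosure _ (Subgroup.mem_zpowers _)⟩ =
      ⟨φ ^ p ^ n, hψCn n⟩ := fun n => by
    haveI : CompactSpace (D n) :=
      isCompact_iff_compactSpace.mp ((hD n).1 |> Subgroup.isClosed_of_isOpen _).isCompact
    let e0 : D n ≃* Cn n := Subgroup.equivMapOfInjective (D n) C.subtype Subtype.val_injective
    have he0 : Continuous e0 :=
      Continuous.subtype_mk (continuous_subtype_val.comp continuous_subtype_val) _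
    have he0' : Continuous e0.symm := Continuous.continuous_symm_of_equiv_compact_to_t2 (f := e0.toEquiv) he0
    let e : D n ≃ₜ* Cn n :=
      { e0 with
        continuous_toFun := he0
        continuous_invFun := he0' }
    refine ⟨e, ?_⟩
    apply Subtype.ext
    change ((e0 ⟨φC ^ p ^ n, _⟩ : Cn n) : Γ) = φ ^ p ^ n
    rw [Subgroup.coe_equivMapOfInjective_apply]
    simp [hφCdef]
  have hfreeCn : ∀ n, FundamentalExtension.IsFreeProcyclic (Cn n) := fun n => by
    obtain ⟨e, -⟩ := eCn n
    exact (hfreeC.of_isOpen (hD n).1).of_continuousMulEquiv e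
  have hdenseCn' : ∀ n, Dense (zpowers (⟨φ ^ p ^ n, hψCn n⟩ : Cn n) : Set (Cn n)) := fun n => by
    obtain ⟨e, he⟩ := eCn n
    have := dense_zpowers_map_continuousMulEquiv e
      (dense_zpowers_pow_subgroupOf hdenseC (hD n).1 (pow_pos hp.pos n) (hD n).2)
    rwa [he] at this
  set G : ℕ → Subgroup Γ := fun n => (Cn n).comap r.toMonoidHom with hGdef
  have hGmem : ∀ n x, x ∈ G n ↔ r x ∈ Cn n := fun n x => Iff.rfl
  have hGc : ∀ n, IsClosed (G n : Set Γ) := fun n => (hCnc n).preimage r.continuous_toFun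
  have hNG : ∀ n, N ≤ G n := fun n x hx => by
    rw [hGmem, (hker x).2 hx]; exact (Cn n).one_mem
  have hCnG : ∀ n, Cn n ≤ G n := fun n x hx => by
    rw [hGmem, hrid x (hCnC n hx)]; exact hx
  have hrCn : ∀ n, ∀ g ∈ G n, r g ∈ Cn n := fun n g hg => hg
  have hψG : ∀ n, φ ^ p ^ n ∈ G n := fun n => hCnG n (hψCn n)
  -- `κ` on `C_n`: multiples of `p^n α`
  have hκCn : ∀ n, ∀ d ∈ Cn n, ∃ β : ℤ_[p], Multiplicative.toAdd (κ d) =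
      (((p ^ n : ℕ) : ℤ_[p]) * Multiplicative.toAdd (κ φ)) * β := fun n d hd =>
    exists_toAdd_eq_of_mem_map_closure κ hφC (p ^ n) hd
  have hα : Multiplicative.toAdd (κ φ) ≠ 0 := fun h0 => hκφ (by
    rw [← ofAdd_toAdd (κ φ), h0]; rfl)
  -- `C ∩ ker κ ⊆ C_n`: the coset decomposition `c = φ^j · d` and `p^n ∣ j`
  have hkerCn : ∀ n, ∀ c ∈ C, κ c = 1 → c ∈ Cn n := by
    intro n c hc hκc
    -- `c_C ∈ φ_C^j · D n`
    have hopen : IsOpen ((fun d : C => (⟨c, hc⟩ : C) * d) '' (D n : Set C)) :=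
      (Homeomorph.mulLeft (⟨c, hc⟩ : C)).isOpenMap _ (hD n).1
    obtain ⟨y, hyimg, hyz⟩ := hdenseC.inter_open_nonempty _ hopen ⟨⟨c, hc⟩, ⟨1, (D n).one_mem, mul_one _⟩⟩
    obtain ⟨d, hdD, hyd⟩ := hyimg
    obtain ⟨j, hj⟩ := Subgroup.mem_zpowers_iff.1 hyz
    -- so `c = φ^j * d⁻¹` with `d⁻¹ ∈ D n`
    have hcd : (⟨c, hc⟩ : C) = φC ^ j * d⁻¹ := by
      rw [hj, ← hyd, mul_inv_cancel_right]
    have hc_eq : c = φ ^ j * ((d⁻¹ : C) : Γ) := by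
      have := congrArg Subtype.val hcd
      simpa [hφCdef] using this
    have hdinv : ((d⁻¹ : C) : Γ) ∈ Cn n := Subgroup.mem_map.2 ⟨d⁻¹, (D n).inv_mem hdD, rfl⟩
    obtain ⟨β, hβ⟩ := hκCn n _ hdinv
    -- `κ c = 1` gives `j α + p^n α β = 0`, hence `p^n ∣ j`
    have hsum : (j : ℤ_[p]) * Multiplicative.toAdd (κ φ) +
        (((p ^ n : ℕ) : ℤ_[p]) * Multiplicative.toAdd (κ φ)) * β = 0 := by
      have h1 := congrArg Multiplicative.toAdd hκc
      rw [hc_eq, map_mul, toAdd_mul, map_zpow, toAdd_zpow, hβ, toAdd_one, zsmul_eq_mul] at h1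
      exact_mod_cast h1
    have hj_eq : (j : ℤ_[p]) = -(((p ^ n : ℕ) : ℤ_[p]) * β) := by
      have h2 : Multiplicative.toAdd (κ φ) * ((j : ℤ_[p]) + ((p ^ n : ℕ) : ℤ_[p]) * β) = 0 := by
        rw [← hsum]; ring
      rcases mul_eq_zero.1 h2 with h3 | h3
      · exact absurd h3 hα
      · linear_combination h3
    have hdvd : ((p : ℤ) ^ n : ℤ) ∣ j := by
      rw [← PadicInt.pow_p_dvd_int_iff]
      refine ⟨-β, ?_⟩
      rw [hj_eq]; push_cast; ring
    obtain ⟨m, hm⟩ := hdvd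
    have hφj : φ ^ j ∈ Cn n := by
      rw [hm, zpow_mul]
      have e1 : φ ^ ((p : ℤ) ^ n) = φ ^ p ^ n := by rw [← zpow_natCast]; push_cast; rfl
      rw [e1]
      exact (Cn n).zpow_mem (hψCn n) m
    rw [hc_eq]
    exact (Cn n).mul_mem hφj hdinv
  have hPG : ∀ n, P ≤ G n := fun n x hx => by
    rw [hGmem]
    refine hkerCn n _ (hrC x) ?_
    rw [← hκr]; exact hx
  -- `⋂ G_n ⊆ P`
  have hGP : ∀ x : Γ, (∀ n, x ∈ G n) → x ∈ P := fun x hx => by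
    have hzero : Multiplicative.toAdd (κ (r x)) = 0 :=
      -- `p^n ∣ κ(r x)` for every `n` (as in the tree's `padicInt_eq_zero_of_forall_pow_dvd`)
      PadicInt.ext_of_toZModPow.mp fun n ↦ by
        rw [map_zero, ← RingHom.mem_ker, PadicInt.ker_toZModPow, Ideal.mem_span_singleton]
        obtain ⟨β, hβ⟩ := hκCn n (r x) (hx n)
        exact ⟨Multiplicative.toAdd (κ φ) * β, by rw [hβ]; push_cast; ring⟩
    change κ.toMonoidHom x = 1
    change κ x = 1
    rw [hκr, ← ofAdd_toAdd (κ (r x)), hzero]; rfl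
  -- antitone
  have hGanti : Antitone G := by
    refine antitone_nat_of_succ_le fun n x hx => ?_
    rw [hGmem] at hx ⊢
    obtain ⟨y, hy, hyx⟩ := Subgroup.mem_map.1 hx
    refine Subgroup.mem_map.2 ⟨y, ?_, hyx⟩
    have hle : D (n + 1) ≤ D n := by
      have := topologicalClosure_zpowers_pow_mul_le φC (p ^ n) p
      rwa [← pow_succ] at this
    exact hle hy
  -- the two directions
  constructor
  · rintro ⟨zc, rfl⟩
    exact exists_conjMap_eq_of_resLe τ hN hNP G hGanti hGc hGP (fun n => φ ^ p ^ n) hψG zc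
  · rintro ⟨n, hn⟩
    obtain ⟨xc, hxc⟩ := exists_resLe_eq_of_conjMap_eq_subgroup τ htor hfin (hGc n) (hNG n) (hCnG n) (hCnc n)
      (hfreeCn n) r (hrCn n) (fun c hc => hrid c (hCnC n hc)) (fun g _ => hker g) (hψCn n) (hdenseCn' n) yc hn
    refine ⟨resLe τ.toTopRep (hPG n) 1 xc, ?_⟩
    rw [← hxc]
    obtain ⟨f, rfl⟩ := oneCocycleClass_surjective _ xc
    rw [resLe_oneCocycleClass, resLe_oneCocycleClass, resLe_oneCocycleClass]
    exact congrArg _ (Subtype.ext (ContinuousMap.ext fun _ => rfl))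

end Tower

end Summit.BirchSwinnertonDyer.BirchSwinnertonDyer.Theorems.SignedTransportAtTwo

end
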